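import Literature.MathematicalPhysics.QuantumFieldTheory.Balaban1983to89.B9Eq373BondPrincipalTwoBackgroundLetter
import Literature.MathematicalPhysics.QuantumFieldTheory.Balaban1983to89.B9Eq326G1kSliceGradRowClosed
import Literature.MathematicalPhysics.QuantumFieldTheory.Balaban1983to89.B9Eq369CurvOpSupLetter
import Literature.MathematicalPhysics.QuantumFieldTheory.Balaban1983to89.B9Ineq369CurvatureSmall
import Literature.MathematicalPhysics.QuantumFieldTheory.Balaban1983to89.B9Eq373TransporterLipschitzLetters

/-!
# `Balaban1983to89.B9Eq373BondHessianTwoBackgroundLetterTower` — T. Bałaban, *Propagators for lattice gauge theories in a background field*, Commun. Math. Phys. **99** (1985)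
# 389–434 [Balaban1985BackgroundPropagators] (3.71)–(3.73) p. 405, (3.69) p. 404 (the curvature part `Δ′`), (3.84)–(3.85) p. 407 (*«hence V(A)G(U) is a small operator in supremum
# norm»*), Thm 3.3 p. 399, Thm 3.11 p. 416: **THE HESSIAN PIECE OF THE TWO-BACKGROUND PERTURBATION OF THE NE9 CHAIN's `k`-LEVEL BOND PROPAGATOR AT THE FLAT BASE, AS A LOCAL
# LETTER WITH THE SMALL FACTOR AND CONSTANTS BEFORE THE LATTICE** — `∃ α₀ K κ > 0` BEFORE `n, η, m, U`: on print's diagonal `ηL^{n+1} = 1`, for every background `U` with `U(b) ∈ U1`,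
# `‖U(b) − 1‖ ≤ αη`, the all-direction window `‖U_μ(x+e_ν) − U_μ(x)‖ ≤ αη²` and small plaquettes `‖U(∂p) − 1‖ ≤ αη²` (`0 ≤ α ≤ α₀`), every source `f` supported over ONE unit
# block `v` with `‖f‖_∞ ≤ F` and every bond `b`: `‖((Δ(U) − Δ(1))G₁,k(1)f)(b)‖ ≤ K·α·e^{−κ d_m(Π(b₋), v)}·F`, `Δ(U) = hessOp φ η U τ = D*_UD_U + Δ′(U)` — brick G-3 of the
# bond storey: `B9Eq373BondPrincipalTwoBackgroundLetter` (principal part) INSTANTIATED at the chain's transporters and fed the crew's VALUE and SLICE-GRADIENT rows of `G₁,k` at the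
# vacuum (`B9Eq326G1kSupRowClosed`, `B9Eq326G1kSliceGradRowClosed`), plus the curvature letter `B9Eq369CurvOpSupLetter.norm_apply_curvOp_le_local` (`Δ′(1) = 0`)

statement-level skeleton of published theorems with citation tags; proofs where landed; nothing here is a claim about the Yang–Mills mass gap

CITATION HEADER (lean-in-tree rule).  Audit cell `pub-balaban`, sub-cell `t4`, BINDER row NE9; NE9 crux-team LEAF PROVER 01 (`b2b-balaban-t4-ne9-formalise-leaf-01`, gen 100;
bears_on: R4/N22).  Composition BY NAME: this gen's `B9Eq373BondPrincipalTwoBackgroundLetter.norm_covLapPrincipal_sub_flat_apply_le_of_letters`; ne9-leaf-05's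
`B9Eq326G1kSupRowClosed.exists_local_letter_G1k` and `B9Eq326G1kSliceGradRowClosed.exists_local_gradLetter_G1k` (read at `U ≡ 1`, `α = 0`); the OWNER's `B9Eq310HessianOperator.{hessOp_apply,
equiv_principalOpK, curvOp_one}`, `B9Eq369CurvOpSupLetter.norm_apply_curvOp_le_local`, `B9Ineq369CurvatureSmall.{norm_reHol_sub_one_le, norm_imHol_le}`, ne9-leaf-04's
`B9Eq373TransporterLipschitzLetters.{norm_adTransportW_sub_adTransportW_le, norm_adTransportW_inv_sub_adTransportW_inv_le}`, `B5Eq172HodgePositivity.adTransportW_one`,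
`B9Eq33CovDerivLocalLetterTower.tdist_bigBlock_bpos_btgt_le_one`, `B9Eq315QTowerFlat` (the flat tower class).  Sources: [Balaban1985BackgroundPropagators] pp. 399, 404–405, 407, 416
(text layer pp. 11, 16–17, 19, 28 read by this lineage 2026-08-28).  NOTHING of print's proofs is reproduced beyond what the named files prove.

WHAT IS PROVED (sorry-free; proof lane — no `def`).
* **`exists_letter_hessOp_sub_flat_G1k_one`** — the statement of the title (the Thm-3.3 rows are the cell's MODEL rows, consumed BY NAME; the flat-side positivity witnesses of
  `Δ_{a,k}(1)`, `Δ′_{a′,k}(1)` DISPLAYED).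
HONEST SCOPE.  One of the four members of `V = Δ_{a,k}(U) − Δ_{a,k}(1)` (the others: `D_UR_kD*_U`, `Q_k†aQ_k` — next bricks; then the resolvent step (3.86)); constants crude (NOT print's);
«NE9 ⇐ the named binders» (O-NE9-1 #5 UNRULED); NE9 NOT PRINTED ∕ NOT PROVED; spine PROVED 0∕9; rung (B)+1 finite T⁴ — NOT infinite volume, NOT mass gap, NOT BetaPertH, NOT Clay.  HONEST
DEPENDENCY: continuum YM on T⁴ ⇐ BetaPertH ∧ nine spine estimates (0/9 proved); BetaPertH ⇐ (D1) ∧ (D4) ∧ CAP+tail; G-an2-4 gates asym, D1 and NE2/3/4.  NEW file; nothing modified.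
Net new unproved facts: 0.
-/

noncomputable section

set_option autoImplicit false

open scoped InnerProductSpace ComplexConjugate BigOperators

namespace Literature.MathematicalPhysics.QuantumFieldTheory.Balaban1983to89.B9Eq373BondHessianTwoBackgroundLetterTower

open B4Sect5Torus (TSite tdist tdist_nonneg tdist_triangle tdist_symm)
open B9SectCLatticeCarrier (Bond Plaq DirPair bpos btgt shift unshift shift_unshift)
open B9Eq311L2Pairing (WL2)
open B9Eq319QprimeTorus (fineP blockCoord)
open B7Prop1Explicit (U1 Wcx boxVec)
open B11Eq103H1Complex (SiteL2K BondL2K)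
open B9Eq310DeltaPrime (plaqHolU plaqHolU_one)
open B9Eq310HessianOperator (adTransportW hessOp principalOpK curvOp hessOp_apply equiv_principalOpK curvOp_one)
open B9Eq315QTorus (perCfg cornerSite)
open B9Eq315QTower (towerP UlevOf)
open B9Eq315QTowerFlat (perCfg_UlevOf_one_mem_U1 norm_Wcx_UlevOf_one_sub_one_le UlevOf_one)
open B9Eq316TowerFlatIsOneStep (towerP_eq_fineP_pow siteCast)
open B9Eq326OperatorTower (laplaceAk G1k)
open B9Eq324DeltaPrimeATower (laplacePrimeAk)
open B9Eq33CovDerivVector (covGrad)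
open B9Eq34CovCurlVector (covLapPrincipal)
open B9Eq33CovDerivLocalLetterTower (tdist_bigBlock_bpos_btgt_le_one)
open B9Eq326G1kSupRowClosed (exists_local_letter_G1k)
open B9Eq326G1kSliceGradRowClosed (exists_local_gradLetter_G1k)
open B9Eq369CurvOpSupLetter (norm_apply_curvOp_le_local)
open B9Ineq369CurvatureSmall (norm_reHol_sub_one_le norm_imHol_le)
open B9Eq373TransporterLipschitzLetters (norm_adTransportW_sub_adTransportW_le norm_adTransportW_inv_sub_adTransportW_inv_le)
open B9Eq373BondPrincipalTwoBackgroundLetter (norm_covLapPrincipal_sub_flat_apply_le_of_letters exp_step_le exp_two_steps_le)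

section Flat

variable {d : ℕ} {P : Fin d → ℕ} {𝔸 : Type*} [Ring 𝔸] [Algebra ℂ 𝔸] {W : Type*} [NormedAddCommGroup W] [InnerProductSpace ℂ W] (φ : W ≃ₗ[ℂ] 𝔸)

/-- The flat transporter family is the identity on every bond. [folklore] [cite: Balaban1985BackgroundPropagators, p.395] -/
theorem adTransportW_one_fun :
    adTransportW φ (fun _ : Bond d P => (1 : 𝔸ˣ)) = fun _ : Bond d P => (LinearMap.id : W →ₗ[ℂ] W) := by
  funext b; exact B5Eq172HodgePositivity.adTransportW_one φ b

omit [Algebra ℂ 𝔸] in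
/-- The inverse flat family is the flat family. [folklore] [cite: Balaban1985BackgroundPropagators, p.395] -/
theorem inv_one_fun :
    (fun b : Bond d P => ((fun _ : Bond d P => (1 : 𝔸ˣ)) b)⁻¹) = fun _ : Bond d P => (1 : 𝔸ˣ) := by
  funext b; simp

end Flat

variable {d : ℕ} (hd : 1 ≤ d) (L : ℕ) [NeZero L] (hL : 1 ≤ L) (hL3 : 3 ≤ L)
  {𝔸 : Type*} [NormedRing 𝔸] [NormedAlgebra ℂ 𝔸] [CompleteSpace 𝔸] [NormOneClass 𝔸] [StarRing 𝔸] [NormedStarGroup 𝔸] [StarModule ℂ 𝔸]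
  {W : Type*} [NormedAddCommGroup W] [InnerProductSpace ℂ W] [FiniteDimensional ℂ W] (φ : W ≃ₗ[ℂ] 𝔸)
  {Mφ Mφ' : ℝ} (hMφ : 0 ≤ Mφ) (hMφ' : 0 ≤ Mφ') (hφ : ∀ w, ‖φ w‖ ≤ Mφ * ‖w‖) (hφ' : ∀ X, ‖φ.symm X‖ ≤ Mφ' * ‖X‖) (hstar : ∀ X : 𝔸, ‖star X‖ ≤ ‖X‖)
  {a : ℝ} (ha : 0 < a) {a' : ℝ} (ha' : 0 < a')
  (τ : 𝔸 →ₗ[ℂ] ℂ) {Cτ : ℝ} (hτ : ∀ X, ‖τ X‖ ≤ Cτ * ‖X‖) (hCτ : 0 ≤ Cτ) {Mτ : ℝ} (hτm : ∀ X Y : 𝔸, ‖τ (X * Y)‖ ≤ Mτ * ‖X‖ * ‖Y‖) (hMτ : 0 ≤ Mτ)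
  {ρw : ℝ} (hρw : 0 ≤ ρw)
  (hτ₁ : ∀ X : 𝔸, τ (star X) = conj (τ X)) (hτ₂ : ∀ X Y : 𝔸, τ (X * Y) = τ (Y * X)) (hφτ : ∀ X Y : 𝔸, ⟪φ.symm X, φ.symm Y⟫_ℂ = τ (star X * Y))

include hd hL hL3 hMφ hMφ' hφ hφ' hstar ha ha' hτ hCτ hτm hMτ hρw hτ₁ hτ₂ hφτ in
set_option maxHeartbeats 1600000 in
/-- **THE HESSIAN PIECE `(Δ(U) − Δ(1))G₁,k(1)` OF (3.85) AT THE NE9 CHAIN, AS A LOCAL LETTER WITH THE SMALL FACTOR, CONSTANTS BEFORE THE LATTICE** — see the module docstring.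
[cite: Balaban1985BackgroundPropagators, (3.71)–(3.73) p.405, (3.69) p.404, (3.84)–(3.85) p.407, Thm 3.3 p.399, Thm 3.11 p.416] -/
theorem exists_letter_hessOp_sub_flat_G1k_one :
    ∃ α₀ K κ : ℝ, 0 < α₀ ∧ 0 ≤ K ∧ 0 < κ ∧
      ∀ (n : ℕ) (η : ℝ) (_hηL : η * (L : ℝ) ^ (n + 1) = 1) (c₀ c₁ : ℝ) [Fact (0 < c₀)] [Fact (0 < c₁)]
        (_hw : c₀ * ((L : ℝ) ^ (n + 1)) ^ d = c₁) (_hρ : |η| ^ d / c₀ ≤ ρw) (m : Fin d → ℕ) [∀ i, NeZero (m i)] (_hm : ∀ i, 1 ≤ m i)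
        (U : Bond d (towerP L m (n + 1)) → 𝔸ˣ) (α : ℝ) (_hα : 0 ≤ α) (_hαle : α ≤ α₀)
        (_hUb : ∀ b, U b ∈ U1 𝔸) (_hUη : ∀ b, ‖(U b : 𝔸) - 1‖ ≤ α * η)
        (_hUw : ∀ (x : TSite d (towerP L m (n + 1))) (μ ν : Fin d), ‖(U (shift ν x, μ) : 𝔸) - (U (x, μ) : 𝔸)‖ ≤ α * η ^ 2)
        (_hpl : ∀ p : B9SectCLatticeCarrier.Plaq d (towerP L m (n + 1)), ‖(plaqHolU U p : 𝔸) - 1‖ ≤ α * η ^ 2)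
        (hpos'₁ : ∀ x : SiteL2K ℂ d (towerP L m (n + 1)) c₀ W, x ≠ 0 →
          0 < RCLike.re ⟪x, laplacePrimeAk L m n φ η (fun _ : Bond d (towerP L m (n + 1)) => (1 : 𝔸ˣ)) a' (c₁ := c₁) x⟫_ℂ)
        (hpos₁ : ∀ x : BondL2K ℂ d (towerP L m (n + 1)) c₀ W, x ≠ 0 →
          0 < RCLike.re ⟪x, laplaceAk L m n φ η (fun _ : Bond d (towerP L m (n + 1)) => (1 : 𝔸ˣ)) hL (fun _ => 0) (fun _ => by norm_num)
            (perCfg_UlevOf_one_mem_U1 L m (n + 1)) (norm_Wcx_UlevOf_one_sub_one_le L m (n + 1) (fun _ => 0) (fun _ => le_rfl)) τ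
            (c₀ := c₀) (c₁ := c₁) a x⟫_ℂ)
        (v : TSite d m) (f : BondL2K ℂ d (towerP L m (n + 1)) c₀ W) (F : ℝ)
        (_hfv : ∀ b, blockCoord (L ^ (n + 1)) m (siteCast (towerP_eq_fineP_pow L m (n + 1)) (bpos b)) ≠ v →
          WL2.equiv ℂ (fun _ : Bond d (towerP L m (n + 1)) => c₀) W f b = 0)
        (_hfF : ∀ b, ‖WL2.equiv ℂ (fun _ : Bond d (towerP L m (n + 1)) => c₀) W f b‖ ≤ F) (b : Bond d (towerP L m (n + 1))),
        ‖WL2.equiv ℂ (fun _ : Bond d (towerP L m (n + 1)) => c₀) W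
            (hessOp φ η U τ
              (G1k L m n φ η (fun _ : Bond d (towerP L m (n + 1)) => (1 : 𝔸ˣ)) hL (fun _ => 0) (fun _ => by norm_num)
                (perCfg_UlevOf_one_mem_U1 L m (n + 1)) (norm_Wcx_UlevOf_one_sub_one_le L m (n + 1) (fun _ => 0) (fun _ => le_rfl)) τ
                (c₀ := c₀) (c₁ := c₁) hpos₁ f) -
             hessOp φ η (fun _ : Bond d (towerP L m (n + 1)) => (1 : 𝔸ˣ)) τ
              (G1k L m n φ η (fun _ : Bond d (towerP L m (n + 1)) => (1 : 𝔸ˣ)) hL (fun _ => 0) (fun _ => by norm_num)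
                (perCfg_UlevOf_one_mem_U1 L m (n + 1)) (norm_Wcx_UlevOf_one_sub_one_le L m (n + 1) (fun _ => 0) (fun _ => le_rfl)) τ
                (c₀ := c₀) (c₁ := c₁) hpos₁ f)) b‖ ≤
          K * α * Real.exp (-(κ * tdist m (blockCoord (L ^ (n + 1)) m (siteCast (towerP_eq_fineP_pow L m (n + 1)) (bpos b))) v)) * F := by
  classical
  -- (0) the two MODEL rows of `G₁,k` (value and slice gradient), `∃`-first, and the constants
  obtain ⟨α₁, B, δ, hα₁, hB, hδ, ROW⟩ := exists_local_letter_G1k hd L hL hL3 φ hMφ hMφ' hφ hφ' hstar ha ha' (ϱ := 1 / 2) (by norm_num) (by norm_num)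
    τ hτ hCτ hτm hMτ hρw hτ₁ hτ₂ hφτ 0
  obtain ⟨α₂, B', δ', hα₂, hB', hδ', GROW⟩ := exists_local_gradLetter_G1k hd L hL hL3 φ hMφ hMφ' hφ hφ' hstar ha ha' (ϱ := 1 / 2) (by norm_num) (by norm_num)
    τ hτ hCτ hτm hMτ hρw hτ₁ hτ₂ hφτ 0
  set κ : ℝ := min δ δ' with hκdef
  have hκ0 : 0 < κ := lt_min hδ hδ'
  have hκδ : κ ≤ δ := min_le_left _ _
  have hκδ' : κ ≤ δ' := min_le_right _ _
  set Nq : ℝ := (Fintype.card (DirPair d) : ℝ) with hNq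
  set Cp : ℝ := 4 * Nq * ((4 * Mφ ^ 2 * Mφ' ^ 2 + 2 * Mφ * Mφ') * B + 2 * (2 * Mφ * Mφ') * (B' * Real.exp κ)) * Real.exp (2 * κ * 1) with hCp
  set Cc : ℝ := 768 * Nq * Mτ * Mφ ^ 2 * ρw * (B * Real.exp (2 * κ * 1)) with hCc
  have hCp0 : 0 ≤ Cp := by positivity
  have hCc0 : 0 ≤ Cc := by positivity
  refine ⟨1, Cp + Cc, κ, one_pos, add_nonneg hCp0 hCc0, hκ0, ?_⟩
  intro n η hηL c₀ c₁ _ _ hw hρ m _ hm U α hα hα1 hUb hUη hUw hpl hpos'₁ hpos₁ v f F hfv hfF b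
  -- (1) lattice facts
  have hLpos : (0 : ℝ) < (L : ℝ) ^ (n + 1) := pow_pos (by exact_mod_cast Nat.pos_of_ne_zero (NeZero.ne L)) _
  have hη : 0 < η := by
    by_contra h; push Not at h; nlinarith [mul_nonpos_of_nonpos_of_nonneg h hLpos.le]
  have hη1 : η ≤ 1 := by
    have hL1 : 1 ≤ L := le_trans (by norm_num) hL3
    have : (1 : ℝ) ≤ (L : ℝ) ^ (n + 1) := one_le_pow₀ (by exact_mod_cast hL1)
    nlinarith
  have hF : 0 ≤ F := (norm_nonneg _).trans (hfF b)
  have hc0 : 0 < c₀ := Fact.out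
  -- names
  set πB : TSite d (towerP L m (n + 1)) → TSite d m := fun x => blockCoord (L ^ (n + 1)) m (siteCast (towerP_eq_fineP_pow L m (n + 1)) x) with hπB
  set g := G1k L m n φ η (fun _ : Bond d (towerP L m (n + 1)) => (1 : 𝔸ˣ)) hL (fun _ => 0) (fun _ => by norm_num) (perCfg_UlevOf_one_mem_U1 L m (n + 1))
    (norm_Wcx_UlevOf_one_sub_one_le L m (n + 1) (fun _ => 0) (fun _ => le_rfl)) τ (c₀ := c₀) (c₁ := c₁) hpos₁ f with hg
  set A : Bond d (towerP L m (n + 1)) → W := WL2.equiv ℂ (fun _ : Bond d (towerP L m (n + 1)) => c₀) W g with hA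
  -- (2) the flat class data for the rows at `(fun _ : Bond d (towerP L m (n + 1)) => (1 : 𝔸ˣ))`, `α := 0`
  have hUε1 : ∀ (j : ℕ) (bd : Bond d (towerP L m (j + 1))), ‖(UlevOf L m (n + 1) (fun _ : Bond d (towerP L m (n + 1)) => (1 : 𝔸ˣ)) j bd : 𝔸) - 1‖ ≤ (fun _ : ℕ => (0 : ℝ)) j := fun j bd => by
    rw [UlevOf_one]; simp
  have hLb1 : ∀ (j : ℕ) (bd : Bond d (towerP L m (j + 1))), UlevOf L m (n + 1) (fun _ : Bond d (towerP L m (n + 1)) => (1 : 𝔸ˣ)) j bd ∈ U1 𝔸 := fun j bd => by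
    rw [UlevOf_one]; exact one_mem _
  have hRlev1 : ∀ (j : ℕ) (bd : Bond d (towerP L m (j + 1))) (w : W), ‖adTransportW φ (UlevOf L m (n + 1) (fun _ : Bond d (towerP L m (n + 1)) => (1 : 𝔸ˣ)) j) bd w‖ ≤ ‖w‖ := fun j bd w => by
    rw [UlevOf_one, B5Eq172HodgePositivity.adTransportW_one, LinearMap.id_apply]
  have hUst1 : ∀ bd : Bond d (towerP L m (n + 1)), star ((fun _ : Bond d (towerP L m (n + 1)) => (1 : 𝔸ˣ)) bd : 𝔸) = ((((fun _ : Bond d (towerP L m (n + 1)) => (1 : 𝔸ˣ)) bd)⁻¹ : 𝔸ˣ) : 𝔸) := fun _ => by simp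
  have hUb1 : ∀ bd : Bond d (towerP L m (n + 1)), (fun _ : Bond d (towerP L m (n + 1)) => (1 : 𝔸ˣ)) bd ∈ U1 𝔸 := fun _ => one_mem _
  have hUη1 : ∀ bd : Bond d (towerP L m (n + 1)), ‖((fun _ : Bond d (towerP L m (n + 1)) => (1 : 𝔸ˣ)) bd : 𝔸) - 1‖ ≤ 0 * η := fun _ => by simp
  have hpl1 : ∀ p : B9SectCLatticeCarrier.Plaq d (towerP L m (n + 1)), ‖(plaqHolU (fun _ : Bond d (towerP L m (n + 1)) => (1 : 𝔸ˣ)) p : 𝔸) - 1‖ ≤ 0 * η ^ 2 := fun _ => by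
    simp [plaqHolU_one]
  have hUgrad1 : ∀ (x : TSite d (towerP L m (n + 1))) (μ : Fin d), ‖((fun _ : Bond d (towerP L m (n + 1)) => (1 : 𝔸ˣ)) (x, μ) : 𝔸) - (fun _ : Bond d (towerP L m (n + 1)) => (1 : 𝔸ˣ)) (unshift μ x, μ)‖ ≤ 0 * η ^ 2 := fun _ _ => by simp
  have hεg1 : ∀ j < n + 1, (fun _ : ℕ => (0 : ℝ)) j ≤ 0 * (1 / 2 : ℝ) ^ j := fun _ _ => by simp
  have hAQ1 : ∑ j ∈ Finset.range (n + 1), (fun _ : ℕ => (0 : ℝ)) j ≤ 0 := by simp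
  -- (3) the two rows at the vacuum
  have hval : ∀ b' : Bond d (towerP L m (n + 1)), ‖A b'‖ ≤ B * Real.exp (-(δ * tdist m (πB (bpos b')) v)) * F := fun b' =>
    ROW n η hηL c₀ c₁ hw hρ m hm (fun _ : Bond d (towerP L m (n + 1)) => (1 : 𝔸ˣ)) (fun _ => 0) (fun _ => le_rfl) (fun _ => by norm_num) (perCfg_UlevOf_one_mem_U1 L m (n + 1))
      (norm_Wcx_UlevOf_one_sub_one_le L m (n + 1) (fun _ => 0) (fun _ => le_rfl)) (fun _ => 0) (fun _ => le_rfl) hUε1 hLb1 0 le_rfl hα₁.le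
      hUst1 hUb1 hUη1 hpl1 hUgrad1 hRlev1 hεg1 hAQ1 hpos'₁ hpos₁ v f F hfv hfF b'
  have hgrad : ∀ (b' : Bond d (towerP L m (n + 1))) (μ : Fin d),
      ‖covGrad ((η : ℂ))⁻¹ (fun _ : Bond d (towerP L m (n + 1)) => (LinearMap.id : W →ₗ[ℂ] W)) A (b', μ)‖ ≤
        B' * Real.exp (-(δ' * tdist m (πB (btgt b')) v)) * F := fun b' μ => by
    have h := (GROW n η hηL c₀ c₁ hw hρ m hm (fun _ : Bond d (towerP L m (n + 1)) => (1 : 𝔸ˣ)) (fun _ => 0) (fun _ => le_rfl) (fun _ => by norm_num) (perCfg_UlevOf_one_mem_U1 L m (n + 1))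
      (norm_Wcx_UlevOf_one_sub_one_le L m (n + 1) (fun _ => 0) (fun _ => le_rfl)) (fun _ => 0) (fun _ => le_rfl) hUε1 hLb1 0 le_rfl hα₂.le
      hUst1 hUb1 hUη1 hpl1 hUgrad1 hRlev1 hεg1 hAQ1 hpos'₁ hpos₁ v f F hfv hfF μ b').2
    rwa [adTransportW_one_fun φ] at h
  -- (4) geometry: one unit step moves the block coordinate by at most 1
  have hstep : ∀ (x : TSite d (towerP L m (n + 1))) (μ : Fin d), tdist m (πB x) (πB (shift μ x)) ≤ 1 := fun x μ =>
    tdist_bigBlock_bpos_btgt_le_one (L := L) (m := m) (k := n + 1) hm (x, μ)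
  have hπs : ∀ (μ : Fin d) (x : TSite d (towerP L m (n + 1))), tdist m (πB x) v ≤ tdist m (πB (shift μ x)) v + 1 := fun μ x => by
    have h := tdist_triangle hm (πB x) (πB (shift μ x)) v
    linarith [hstep x μ]
  have hπu : ∀ (μ : Fin d) (x : TSite d (towerP L m (n + 1))), tdist m (πB x) v ≤ tdist m (πB (unshift μ x)) v + 1 := fun μ x => by
    have h1 := hstep (unshift μ x) μ
    rw [shift_unshift, tdist_symm hm] at h1
    have h := tdist_triangle hm (πB x) (πB (unshift μ x)) v
    linarith
  -- (5) both rows at the common rate `κ`, the gradient row re-based at `b₋`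
  set E : ℝ := Real.exp (-(κ * tdist m (πB (bpos b)) v)) with hE
  have hweak : ∀ {r : ℝ} (t : ℝ), κ ≤ r → 0 ≤ t → Real.exp (-(r * t)) ≤ Real.exp (-(κ * t)) := fun t hr ht =>
    Real.exp_le_exp.mpr (by nlinarith)
  have hvalκ : ∀ (x : TSite d (towerP L m (n + 1))) (μ : Fin d), ‖A (x, μ)‖ ≤ B * Real.exp (-(κ * tdist m (πB x) v)) * F := fun x μ =>
    (hval (x, μ)).trans (mul_le_mul_of_nonneg_right (mul_le_mul_of_nonneg_left (hweak _ hκδ (tdist_nonneg _ _ _)) hB) hF)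
  have hgradκ : ∀ (x : TSite d (towerP L m (n + 1))) (μ ν : Fin d),
      ‖covGrad ((η : ℂ))⁻¹ (fun _ : Bond d (towerP L m (n + 1)) => (LinearMap.id : W →ₗ[ℂ] W)) A ((x, μ), ν)‖ ≤
        (B' * Real.exp κ) * Real.exp (-(κ * tdist m (πB x) v)) * F := fun x μ ν => by
    refine (hgrad (x, μ) ν).trans ?_
    have h1 : Real.exp (-(δ' * tdist m (πB (btgt (x, μ))) v)) ≤ Real.exp (-(κ * tdist m (πB (shift μ x)) v)) := hweak _ hκδ' (tdist_nonneg _ _ _)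
    have h2 := exp_step_le (κ := κ) (ρ := 1) hκ0.le (hπs μ x)
    rw [mul_one] at h2
    calc B' * Real.exp (-(δ' * tdist m (πB (btgt (x, μ))) v)) * F ≤ B' * (Real.exp κ * Real.exp (-(κ * tdist m (πB x) v))) * F := by
          gcongr; exact h1.trans h2
      _ = (B' * Real.exp κ) * Real.exp (-(κ * tdist m (πB x) v)) * F := by ring
  -- (6) the transporter letters: `ε = 2M_φM_φ′αη`, `ε′ = 2M_φM_φ′αη²`, `‖c‖ = η⁻¹`
  have hRε : ∀ (bd : Bond d (towerP L m (n + 1))) (w : W), ‖adTransportW φ U bd w - w‖ ≤ 2 * Mφ * Mφ' * (α * η) * ‖w‖ := fun bd w => by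
    have h := norm_adTransportW_sub_adTransportW_le φ hφ hφ' hMφ' U (fun _ : Bond d (towerP L m (n + 1)) => (1 : 𝔸ˣ)) bd bd (hUb bd) (hUb1 bd) w
    rw [B5Eq172HodgePositivity.adTransportW_one, LinearMap.id_apply, Units.val_one] at h
    exact h.trans (by gcongr; exact hUη bd)
  have hSε : ∀ (bd : Bond d (towerP L m (n + 1))) (w : W), ‖adTransportW φ (fun bd => (U bd)⁻¹) bd w - w‖ ≤ 2 * Mφ * Mφ' * (α * η) * ‖w‖ := fun bd w => by
    have h := norm_adTransportW_inv_sub_adTransportW_inv_le φ hφ hφ' hMφ' U (fun _ : Bond d (towerP L m (n + 1)) => (1 : 𝔸ˣ)) bd bd (hUb bd) (hUb1 bd) w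
    rw [inv_one_fun, B5Eq172HodgePositivity.adTransportW_one, LinearMap.id_apply, Units.val_one] at h
    exact h.trans (by gcongr; exact hUη bd)
  have hRε' : ∀ (x : TSite d (towerP L m (n + 1))) (lam μ : Fin d) (w : W),
      ‖adTransportW φ U (unshift lam x, μ) w - adTransportW φ U (x, μ) w‖ ≤ 2 * Mφ * Mφ' * (α * η ^ 2) * ‖w‖ := fun x lam μ w => by
    have h := norm_adTransportW_sub_adTransportW_le φ hφ hφ' hMφ' U U (unshift lam x, μ) (x, μ) (hUb _) (hUb _) w
    refine h.trans ?_
    have hw' : ‖(U (unshift lam x, μ) : 𝔸) - (U (x, μ) : 𝔸)‖ ≤ α * η ^ 2 := by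
      have h1 := hUw (unshift lam x) μ lam
      rw [shift_unshift] at h1
      rwa [norm_sub_rev]
    gcongr
  have hcn : ‖((η : ℂ))⁻¹‖ = η⁻¹ := by rw [norm_inv, Complex.norm_real, Real.norm_eq_abs, abs_of_pos hη]
  have hc : ((η : ℂ))⁻¹ ≠ 0 := inv_ne_zero (by exact_mod_cast hη.ne')
  -- (7) THE PRINCIPAL PART by G-2
  have hP := norm_covLapPrincipal_sub_flat_apply_le_of_letters ((η : ℂ))⁻¹ (adTransportW φ U) (adTransportW φ fun bd => (U bd)⁻¹) hc
    (by positivity) (by positivity) hRε hSε hRε' πB (fun y => tdist m y v) zero_le_one hκ0.le hB (by positivity) hF hπs hπu A hvalκ hgradκ (bpos b) b.2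
  -- (8) THE CURVATURE PART by the local letter of `Δ′(U)`
  have hU2 : ∀ bd : Bond d (towerP L m (n + 1)), ‖(U bd : 𝔸)‖ ≤ 1 ∧ ‖(((U bd)⁻¹ : 𝔸ˣ) : 𝔸)‖ ≤ 1 := fun bd => (B7Prop1Explicit.mem_U1).1 (hUb bd)
  have hπs' : ∀ (μ : Fin d) (x : TSite d (towerP L m (n + 1))), tdist m (πB (shift μ x)) v ≤ tdist m (πB x) v + 1 := fun μ x => by
    have h1 := hstep x μ
    rw [tdist_symm hm] at h1
    have h := tdist_triangle hm (πB (shift μ x)) (πB x) v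
    linarith
  set M : ℝ := B * (Real.exp (κ * 2) * E) * F with hM
  have hnear : ∀ (y : TSite d (towerP L m (n + 1))) (ν : Fin d), tdist m (πB (bpos b)) v ≤ tdist m (πB y) v + 2 → ‖A (y, ν)‖ ≤ M := fun y ν hy =>
    (hvalκ y ν).trans (mul_le_mul_of_nonneg_right (mul_le_mul_of_nonneg_left (exp_step_le hκ0.le hy) hB) hF)
  have hC : ‖WL2.equiv ℂ (fun _ : Bond d (towerP L m (n + 1)) => c₀) W (curvOp φ τ η U g) b‖ ≤
      768 * Fintype.card (DirPair d) * Mτ * Mφ ^ 2 * (‖((η : ℂ)) ^ d‖ / c₀) * ‖((η : ℂ))⁻¹‖ ^ 2 * (α * η ^ 2) * M := by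
    refine norm_apply_curvOp_le_local φ hφ hMφ hstar τ hτm hMτ η U hU2 (by positivity) (fun p => norm_reHol_sub_one_le hU2 (hpl p)) (fun p => norm_imHol_le hU2 (hpl p))
      g b (by positivity) (fun x q hb => ?_)
    -- the four bonds of a plaquette through `b` have base points within two steps of `b₋`
    have h0 : ∀ (y : TSite d (towerP L m (n + 1))), tdist m (πB y) v ≤ tdist m (πB y) v + 2 := fun y => by linarith
    rcases hb with hb | hb | hb | hb
    · have hx : bpos b = x := by rw [hb]
      rw [hx] at hnear
      linarith [hnear x q.1.1 (h0 x), hnear x q.1.2 (h0 x), hnear (shift q.1.1 x) q.1.2 (by linarith [hπs q.1.1 x]),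
        hnear (shift q.1.2 x) q.1.1 (by linarith [hπs q.1.2 x])]
    · have hx : bpos b = x := by rw [hb]
      rw [hx] at hnear
      linarith [hnear x q.1.1 (h0 x), hnear x q.1.2 (h0 x), hnear (shift q.1.1 x) q.1.2 (by linarith [hπs q.1.1 x]),
        hnear (shift q.1.2 x) q.1.1 (by linarith [hπs q.1.2 x])]
    · have hx : bpos b = shift q.1.1 x := by rw [hb]
      rw [hx] at hnear
      linarith [hnear x q.1.1 (by linarith [hπs' q.1.1 x]), hnear x q.1.2 (by linarith [hπs' q.1.1 x]), hnear (shift q.1.1 x) q.1.2 (h0 _),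
        hnear (shift q.1.2 x) q.1.1 (by linarith [hπs' q.1.1 x, hπs q.1.2 x])]
    · have hx : bpos b = shift q.1.2 x := by rw [hb]
      rw [hx] at hnear
      linarith [hnear x q.1.1 (by linarith [hπs' q.1.2 x]), hnear x q.1.2 (by linarith [hπs' q.1.2 x]),
        hnear (shift q.1.1 x) q.1.2 (by linarith [hπs' q.1.2 x, hπs q.1.1 x]), hnear (shift q.1.2 x) q.1.1 (h0 _)]
  -- (9) numerics: `‖c‖ = η⁻¹`, `η^d∕c₀ ≤ ρ_w`, `α² ≤ α`
  have hηd : ‖((η : ℂ)) ^ d‖ = η ^ d := by rw [norm_pow, Complex.norm_real, Real.norm_eq_abs, abs_of_pos hη]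
  have hρ' : η ^ d / c₀ ≤ ρw := by rwa [abs_of_pos hη] at hρ
  have hηne : η ≠ 0 := hη.ne'
  have e1 : η⁻¹ ^ 2 * (2 * Mφ * Mφ' * (α * η)) ^ 2 = (2 * Mφ * Mφ') ^ 2 * α ^ 2 := by field_simp
  have e2 : η⁻¹ ^ 2 * (2 * Mφ * Mφ' * (α * η ^ 2)) = 2 * Mφ * Mφ' * α := by field_simp
  have e3 : η⁻¹ * (2 * Mφ * Mφ' * (α * η)) = 2 * Mφ * Mφ' * α := by field_simp
  have e4 : η⁻¹ ^ 2 * (α * η ^ 2) = α := by field_simp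
  have hαsq : (2 * Mφ * Mφ') ^ 2 * α ^ 2 ≤ 4 * Mφ ^ 2 * Mφ' ^ 2 * α := by
    have : α ^ 2 ≤ α := by nlinarith
    nlinarith [mul_nonneg (mul_nonneg hMφ hMφ') (mul_nonneg hMφ hMφ')]
  rw [hcn, e1, e2, e3] at hP
  have hP2 : ‖covLapPrincipal ((η : ℂ))⁻¹ (adTransportW φ U) (adTransportW φ fun bd => (U bd)⁻¹) A (bpos b, b.2) -
        covLapPrincipal ((η : ℂ))⁻¹ (fun _ : Bond d (towerP L m (n + 1)) => (LinearMap.id : W →ₗ[ℂ] W)) (fun _ => LinearMap.id) A (bpos b, b.2)‖ ≤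
      4 * (Fintype.card (DirPair d) : ℝ) * ((4 * Mφ ^ 2 * Mφ' ^ 2 * α + 2 * Mφ * Mφ' * α) * B + 2 * (2 * Mφ * Mφ' * α) * (B' * Real.exp κ)) *
        Real.exp (2 * κ * 1) * E * F := hP.trans (by gcongr)
  have hP3 : 4 * (Fintype.card (DirPair d) : ℝ) * ((4 * Mφ ^ 2 * Mφ' ^ 2 * α + 2 * Mφ * Mφ' * α) * B + 2 * (2 * Mφ * Mφ' * α) * (B' * Real.exp κ)) *
        Real.exp (2 * κ * 1) * E * F = Cp * α * E * F := by rw [hCp]; ring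
  rw [hcn, hηd] at hC
  have hC2 : ‖WL2.equiv ℂ (fun _ : Bond d (towerP L m (n + 1)) => c₀) W (curvOp φ τ η U g) b‖ ≤ Cc * α * E * F := by
    refine hC.trans ?_
    have h1 : 768 * Fintype.card (DirPair d) * Mτ * Mφ ^ 2 * (η ^ d / c₀) * η⁻¹ ^ 2 * (α * η ^ 2) * M =
        768 * Fintype.card (DirPair d) * Mτ * Mφ ^ 2 * (η ^ d / c₀) * (η⁻¹ ^ 2 * (α * η ^ 2)) * M := by ring
    rw [h1, e4]
    have h2 : Cc * α * E * F = 768 * Fintype.card (DirPair d) * Mτ * Mφ ^ 2 * ρw * α * M := by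
      rw [hCc, hM, show κ * 2 = 2 * κ * 1 by ring]; ring
    rw [h2]
    have hM0 : 0 ≤ M := by positivity
    gcongr
  -- (10) assembly: `Δ(U) − Δ(1) = (D*_UD_U − D*_1D_1) + Δ′(U)` pointwise
  have hread : WL2.equiv ℂ (fun _ : Bond d (towerP L m (n + 1)) => c₀) W (hessOp φ η U τ g - hessOp φ η (fun _ : Bond d (towerP L m (n + 1)) => (1 : 𝔸ˣ)) τ g) b =
      (covLapPrincipal ((η : ℂ))⁻¹ (adTransportW φ U) (adTransportW φ fun bd => (U bd)⁻¹) A (bpos b, b.2) -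
        covLapPrincipal ((η : ℂ))⁻¹ (fun _ : Bond d (towerP L m (n + 1)) => (LinearMap.id : W →ₗ[ℂ] W)) (fun _ => LinearMap.id) A (bpos b, b.2)) +
      WL2.equiv ℂ (fun _ : Bond d (towerP L m (n + 1)) => c₀) W (curvOp φ τ η U g) b := by
    rw [hessOp_apply, hessOp_apply, curvOp_one, LinearMap.zero_apply, add_zero, WL2.equiv_sub, WL2.equiv_add, Pi.sub_apply,
      Pi.add_apply, equiv_principalOpK, equiv_principalOpK, inv_one_fun, adTransportW_one_fun φ]
    change covLapPrincipal _ _ _ A (bpos b, b.2) + _ - covLapPrincipal _ _ _ A (bpos b, b.2) = _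
    abel
  rw [hread]
  calc ‖(covLapPrincipal ((η : ℂ))⁻¹ (adTransportW φ U) (adTransportW φ fun bd => (U bd)⁻¹) A (bpos b, b.2) -
          covLapPrincipal ((η : ℂ))⁻¹ (fun _ : Bond d (towerP L m (n + 1)) => (LinearMap.id : W →ₗ[ℂ] W)) (fun _ => LinearMap.id) A (bpos b, b.2)) +
        WL2.equiv ℂ (fun _ : Bond d (towerP L m (n + 1)) => c₀) W (curvOp φ τ η U g) b‖
      ≤ Cp * α * E * F + Cc * α * E * F := (norm_add_le _ _).trans (add_le_add (hP2.trans hP3.le) hC2)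
    _ = (Cp + Cc) * α * E * F := by ring

end Literature.MathematicalPhysics.QuantumFieldTheory.Balaban1983to89.B9Eq373BondHessianTwoBackgroundLetterTower

end
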